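import Summits.BirchSwinnertonDyer.BirchSwinnertonDyer.Theorems.ByReductionTypeAtTwoOrdKatoHalfAtTwoIsoColemanMuFreeValueOrdKernel
import Summits.BirchSwinnertonDyer.BirchSwinnertonDyer.Theorems.ByReductionTypeAtTwoOrdKatoHalfAtTwoIsoPosDiscNecessity
import Summits.BirchSwinnertonDyer.BirchSwinnertonDyer.Theorems.ByReductionTypeAtTwoOrdKatoHalfAtTwoIsoPosDiscSplit
import Summits.BirchSwinnertonDyer.BirchSwinnertonDyer.Theorems.ByReductionTypeAtTwoOrdKatoHalfAtTwoIsoGreenbergMuNegDefs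
import Summits.BirchSwinnertonDyer.BirchSwinnertonDyer.Theorems.ByReductionTypeAtTwoOrdKatoHalfAtTwoIsoZetaColemanMuIotaKatoCarriers
import Literature.NumberTheory.EllipticCurves.Kato2004.IwasawaH1ZetaQuotientMuProofs
import HarnessLib

/-!
# Route ByReductionTypeAtTwo, crux `OrdKatoHalfAtTwoIso` (stmt-BirchSwinnertonDyer-19573), line `steinberg-fibre-at-two`,
# F1 slot (child stmt-BirchSwinnertonDyer-24097), `Δ < 0` cell: the registered memo stub V♭⁻ SPLITS LOSSLESSLY —
# V♭⁻ ⟺ G11⁻ ∧ MU13⁻ in the kernel modulo print (Greenberg's Conjecture 1.11 at `2` on the cell ∧ «`μ(𝐇¹_Γ(T₂W)/Λz) = 0` for a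
# GENUINE Euler-system class `z`»)

Seat `cruxlead-stmt-BirchSwinnertonDyer-19573-w3` g7 (prover WIDTH under the LEAD `cruxlead-19573` g10; HOME `run/shared/lean/pub/bsd-2adic/`;
`--supports` stmt-BirchSwinnertonDyer-24097). THEOREMS ONLY (no definition, no named fact, no `sorry`, no instance). HONEST FRAMING (cell
bsd-2adic): BSD is not proved by any of this; F1μι⁻, the children and the crux are NOT proved here; V♭⁻ (the text of
`stub_muFreeValue_negDisc_two` of skeleton v24 `4921f2ec`), G11⁻ (`GreenbergMuZeroTwoOrdNegDisc`, published conjecture) and MU13⁻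
(`ZetaQuotientMuZeroTwoOrdNegDisc`, memo) are displayed OPEN statements; every theorem below is CONDITIONAL on the ones it names, and on
the Literature named facts p729889 (`Kato2004.exists_lambdaAdicLocalTatePairing_poitouTate_exact`, Poitou–Tate exactness on Kato's carriers,
print-composite, every `p`), p723619 (its projection), p727215 (`Kato2004.exists_ordinaryKernelFunctional`), `Kato2004.thm12_4` (Thm. 12.4 (2))
and PUB (`OrdPublishedInputsAtTwo`: modularity + Kato 17.4 (1)(2) at `2`, rank-free) where they appear as hypotheses.

WHY (pricing of the line's ONLY `Δ < 0` memo stub). The lead g10's sign-free NECESSITY display `greenbergMu_two_onto_necessary` shows that the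
crux IMPLIES Greenberg's `μ = 0` at `2` on the whole onto habitat (mod PUB + Cassels + Abbes–Ullmo); on `0 < Δ` v24 registers exactly that
(G11⁺, w3 g6 p733065), on `Δ < 0` it registers the memo-level SUFFICIENT condition V♭⁻ («every normalised ordinary-kernel functional takes a
value `∉ (2)` at `loc₂ g` of some GENUINE Euler-system class `g`»). THIS FILE computes the EXACT EXCESS of V♭⁻ over Greenberg's conjecture:
* §1 `moduleFinite_selmerDual_of_greenbergMuNeg` (G11⁻ + PUB ⟹ `X(W/ℚ_∞)` f.g. over `ℤ₂`, rank-free: cotorsion is Kato 17.4 (1) at `2`);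
  **(⇐) `muFreeValue_negDisc_of_greenbergMuNeg_of_zetaQuotientMu`: p729889 + PUB + G11⁻ + MU13⁻ ⟹ V♭⁻ VERBATIM** — g6's
  `exists_notMem_col_loc_of_poitouTate_of_moduleFinite` gives SOME global class with a `μ`-free value, and `μ(𝐇¹_Γ/Λz) = 0` moves it to the
  genuine class `z` (w3 g7 Literature `notMem_col_loc_of_poitouTate_of_moduleFinite_quotient_span`: `X`-monic relations, `(2)` prime).
* §2 **(⇒) `greenbergMuZeroTwoOrdNegDisc_of_muFreeValue_negDisc`: p723619 + p727215 + PUB + V♭⁻ ⟹ G11⁻** (V♭⁻ ⇒ F1μι⁻ by w3 g5's p727801,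
  F1μι⁻ ⇒ `μ = 0` by the lead's `mu_eq_zero_of_iotaNegDisc` over the PROVED core Theorem A at `2` on `Δ < 0`; the newform from modularity);
  **`zetaQuotientMuZeroTwoOrdNegDisc_of_muFreeValue_negDisc`: `thm12_4` + p727215 + PUB + V♭⁻ ⟹ MU13⁻** (at the place over `2`, a normalised
  local generator and the pinned local carriers — all EXIST as theorems —, the functional of p727215 and the genuine class of V♭⁻; then
  `col ∘ loc₂` is injective on the torsion-free rank-`1` `𝐇¹_Γ` and `𝐇¹_Γ ⧸ Λz ↪ Λ ⧸ (col(loc₂ z))`, f.g. over `ℤ₂` by Weierstrass).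
* §3 `muFreeValue_negDisc_iff_greenbergMuNeg_and_zetaQuotientMu`: the EQUIVALENCE modulo {p729889, p727215, thm12_4, PUB} BY NAME, and
  `zetaColemanMuIotaNegDiscAtTwo_of_greenbergMuNeg_of_zetaQuotientMu`: F1μι⁻ (= conjunct 1 of child 24097) ⟸ p729889 + p727215 + PUB + G11⁻ + MU13⁻;
  `ordKatoFineZetaAtTwoResidue_of_greenbergMuNeg_of_zetaQuotientMu_of_posDisc`: child 24097 BY NAME ⟸ the same + its `0 < Δ` conjunct (= G11⁺ +
  print by w3 g6's p734050).
* §4 `mainConjectureLowerDivisibilityAtTwoOrd_negDisc_of_greenbergMuNeg` (G11⁻ + Abbes–Ullmo + Kato 17.4 (1)(2) at `2` ⟹ the Kato–Néron half AT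
  `W` on the whole `Δ < 0` cell, any rank — the sign-free DIRECT road), `ordKatoHalfAtTwoIso_negDisc_of_greenbergMuNeg` (the crux on the `Δ < 0`
  habitat cell, `W′ := W`) and NECESSITY `greenbergMuZeroTwoOrdNegDisc_habitat_of_ordKatoHalfAtTwoIso` (crux + PUB + Cassels + Abbes–Ullmo ⟹
  G11⁻ restricted to the habitat; the `Δ < 0` half of the lead's display `greenbergMu_two_onto_necessary`, ported to Theorems).
* §5 (appended) `exists_isEulerSystemClassTwo_not_mem_two_smul_top_of_zetaQuotientMu` (MU13⁻ + `thm12_4` ⟹ at every curve of the `Δ < 0`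
  cell some GENUINE class is NOT in `(2)·𝐇¹_Γ`) and `not_forall_isEulerSystemClassTwo_mem_two_smul_top_of_zetaQuotientMu` (MU13⁻ refutes the
  `2`-divisibility hypothesis of the Negative lemma p691215 on the whole `Δ < 0` cell).
So the registered `Δ < 0` memo content = ONE published conjecture (G11⁻, NECESSARY for the crux on the habitat) + ONE statement internal to Kato's
Euler system in Iwasawa cohomology (MU13⁻: no Coleman map, pairing, `L`-function or functional) — the `Δ < 0` analogue of crux-triage r1-1
GEN 45 F-45b's lossless merge {V♭⁺, Q⁺} ↦ G11⁺. Whether to re-register is the LEAD's call; nothing here changes skeleton v24.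

References: [Kato2004Asterisque] Thm. 12.4 (2) (p. 221), Thm. 17.4 (p. 273), Prop. 17.11 (p. 277), §17.13 (pp. 279–280); [GreenbergLNM1716] Conj. 1.11
(p. 64), §4 p. 122; [MilneADT2006] I Thm. 4.10; [Washington1997] §7.1, §13.2; tree p727025, p727215, p727801, p729889, p733065, p733613, p734050,
`…PosDiscSplit` (`mu_eq_zero_of_iotaNegDisc`), `…ZetaColemanMuIotaKatoCarriers` (carrier existence pattern), w3 g7 `Kato2004/IwasawaH1ZetaQuotientMuProofs`.
-/

set_option autoImplicit false
set_option linter.dupNamespace false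

noncomputable section

open scoped Classical MatrixGroups ModularForm NumberField
open CongruenceSubgroup WeierstrassCurve Field IsDedekindDomain NumberField
open Literature.NumberTheory.GaloisRepresentations
open Literature.NumberTheory.GaloisCohomology
open Literature.NumberTheory.EllipticCurves Literature.NumberTheory.EllipticCurves.ModularForms
  Literature.NumberTheory.EllipticCurves.GreenbergSelmer
open Literature.NumberTheory.EllipticCurves.Kato2004
  Literature.NumberTheory.EllipticCurves.Kato2004.EulerSystemValues
open Literature.NumberTheory.EllipticCurves.IwasawaDual
open Literature.NumberTheory.EllipticCurves.Rank1Residual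
open Literature.NumberTheory.EllipticCurves.Greenberg1999
open Summit.BirchSwinnertonDyer.Rank1Residual Summit.BirchSwinnertonDyer.Rank1Residual.X5
open Summit.BirchSwinnertonDyer.BirchSwinnertonDyer.Theses.ByReductionTypeAtTwo

namespace Summit.BirchSwinnertonDyer.BirchSwinnertonDyer.Theorems.SteinbergFibreAtTwo

/-! ## §1 (⇐) G11⁻ + MU13⁻ ⟹ V♭⁻, over the Poitou–Tate exactness fact and PUB -/

/-- **G11⁻ + PUB ⟹ `X(W/ℚ_∞)` is finitely generated over `ℤ₂`** for every curve of the `Δ < 0` cell (ANY rank, CM or not) and every normalised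
cyclotomic datum: `Sel` is cotorsion by Kato 17.4 (1) at `2` (PUB, at the conductor-level newform from modularity — rank-free), and for a finitely
generated torsion `Λ`-module `μ = 0 ⟺` finitely generated over `ℤ₂` (`muInvariant_eq_zero_iff`). The `Δ < 0` twin of w3 g6's
`moduleFinite_selmerDual_of_greenbergMuZero`. CONDITIONAL; nothing closed.
[cite: GreenbergLNM1716, Conj. 1.11 (p. 64)] [cite: Kato2004Asterisque, Thm. 17.4 (1) (p. 273)] [cite: Washington1997, §13.2] -/
theorem moduleFinite_selmerDual_of_greenbergMuNeg (hG : GreenbergMuZeroTwoOrdNegDisc) (hPub : OrdPublishedInputsAtTwo)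
    (W : WeierstrassCurve ℚ) [W.IsElliptic] [W.IsGloballyMinimal]
    (hgo : GoodOrd W 2) (h2 : W.HasSurjectiveModNGaloisRep 2) (hΔ : W.Δ < 0)
    {κ : ZpExtension ℚ 2} {γ : absoluteGaloisGroup ℚ} (hκ : κ.IsCyclotomic) (hγ : κ.IsTopGenerator γ)
    (hγ' : IsCyclotomicVariable 2 γ) (D : W.SelmerDualData κ γ) :
    Module.Finite ℤ_[2] (RestrictScalars ℤ_[2] (IwasawaAlgebra 2) D.X) := by
  obtain ⟨hmod, -, h17, -⟩ := hPub
  haveI : NeZero (W.conductorNorm ℤ) := ⟨(W.conductorNorm_pos_holds).ne'⟩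
  obtain ⟨Dm⟩ := hmod W
  haveI : Module.Finite (IwasawaAlgebra 2) D.X := D.module_finite_holds hγ
  have hDt : D.IsTorsion := (h17 W Dm.f κ γ hκ hγ hγ' ⟨hgo.1, hgo.2⟩ Dm.isNewformOf D).1
  exact (muInvariant_eq_zero_iff_holds 2 D.X hDt).mp (hG W hgo h2 hΔ κ γ hκ hγ hγ' D)

/-- **(⇐) G11⁻ + MU13⁻ ⟹ V♭⁻ VERBATIM** (the registered text of `stub_muFreeValue_negDisc_two`, skeleton v24), from the Poitou–Tate exactness fact
p729889 and PUB: for every curve of the `Δ < 0` cell, all carriers and every NORMALISED ordinary-kernel functional `col`, the GENUINE class `z`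
of MU13⁻ has `col (loc₂ z) ∉ (2)` — g6's `exists_notMem_col_loc_of_poitouTate_of_moduleFinite` ((E) exact at `2` + `X` f.g. over `ℤ₂`, §1)
gives SOME `y ∈ 𝐇¹_Γ` with a `μ`-free value, and `μ(𝐇¹_Γ/Λz) = 0` moves it to `z` (`Kato2004.notMem_col_loc_of_poitouTate_of_moduleFinite_quotient_span`:
an `X`-monic `g ∉ (2)` with `g•y ∈ Λz`, `(2)` prime). CONDITIONAL on the displayed OPEN statements; nothing closed.
[cite: Kato2004Asterisque, §17.13 (17.13.1)–(17.13.3) (pp. 279–280)] [cite: GreenbergLNM1716, Conj. 1.11 (p. 64), §4 p. 122] [cite: MilneADT2006, I Thm. 4.10] -/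
theorem muFreeValue_negDisc_of_greenbergMuNeg_of_zetaQuotientMu (hPT : exists_lambdaAdicLocalTatePairing_poitouTate_exact)
    (hPub : OrdPublishedInputsAtTwo) (hG : GreenbergMuZeroTwoOrdNegDisc) (hZ : ZetaQuotientMuZeroTwoOrdNegDisc) :
    ∀ (W : WeierstrassCurve ℚ) [W.IsElliptic] [W.IsGloballyMinimal]
      [ContinuousSMul ℤ_[2] (W.tateModule 2)] [Module.Free ℤ_[2] (W.tateModule 2)] [Module.Finite ℤ_[2] (W.tateModule 2)]
      {N : ℕ} [NeZero N] (f : CuspForm (Gamma0 N) 2)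
      (κ : ZpExtension ℚ 2) (γ : absoluteGaloisGroup ℚ) (hκ : κ.IsCyclotomic) (hγ : κ.IsTopGenerator γ),
      W.Δ < 0 → IsOrdinaryAt W 2 → W.HasSurjectiveModNGaloisRep 2 → IsCyclotomicVariable 2 γ → IsNewformOf W f →
      ∀ (v₂ : HeightOneSpectrum (𝓞 ℚ)) (_ : ((2 : ℕ) : 𝓞 ℚ) ∈ v₂.asIdeal)
        (γᵥ : absoluteGaloisGroup (v₂.adicCompletion ℚ))
        (hsurj : Function.Surjective
          (κ.toContinuousMonoidHom.comp (resGalOfEmb (closureEmb (K := ℚ) (v₂.adicCompletion ℚ)))))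
        (hγᵥ : κ.IsTopGenerator (resGalOfEmb (closureEmb (K := ℚ) (v₂.adicCompletion ℚ)) γᵥ))
        (I : IwasawaH1Data W 2 κ γ) (J : LocalIwasawaH1Data κ v₂ ((tateRep W 2).toLocal v₂) γᵥ)
        (J' : LocalIwasawaH1Data κ v₂ (tateLocalOrdinaryRep W 2 v₂) γᵥ)
        (col : J.H →ₗ[IwasawaAlgebra 2] IwasawaAlgebra 2),
        (∀ x : J.H, col x = 0 ↔ x ∈ LinearMap.range (J'.ordinaryInclusion J)) →
        (∃ x : J.H, col x ∉ IwasawaAlgebra.augIdealP 2) →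
        ∃ g : I.H, IsEulerSystemClassTwo W hκ I g ∧ col (I.loc J hsurj hγ hγᵥ g) ∉ IwasawaAlgebra.augIdealP 2 := by
  intro W _ _ _ _ _ N _ f κ γ hκ hγ hΔ hord h2 hγ' _ v₂ hv₂ γᵥ hsurj hγᵥ I J J' col hker hnorm
  obtain ⟨D⟩ := W.nonempty_selmerDualData_holds κ γ hγ
  obtain ⟨z, hz, hzfin⟩ := hZ W κ γ hκ hγ hΔ hord h2 hγ' I
  exact ⟨z, hz, notMem_col_loc_of_poitouTate_of_moduleFinite_quotient_span hPT W κ γ hκ hγ hord v₂ hv₂ γᵥ hsurj hγᵥ I J J' D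
    (moduleFinite_selmerDual_of_greenbergMuNeg hG hPub W ⟨hord.1, hord.2⟩ h2 hΔ hκ hγ hγ' D) z hzfin col
    (fun y => (hker _).mpr ⟨y, rfl⟩) hnorm⟩

/-! ## §2 (⇒) V♭⁻ ⟹ G11⁻ and V♭⁻ ⟹ MU13⁻ -/

/-- **(⇒, first half) V♭⁻ ⟹ G11⁻** over the two cite facts of the line (p723619 Tate duality along the tower, p727215 the ordinary-kernel functional)
and PUB (modularity, for a newform of `W`): V♭⁻ ⟹ F1μι⁻ (w3 g5's p727801 `zetaColemanMuIotaNegDiscAtTwo_of_tateDuality_of_ordKernel_of_muFreeValue`)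
⟹ `μ(X) = 0` for every normalised cyclotomic dual datum on the cell (the lead's `mu_eq_zero_of_iotaNegDisc`, whose engine is the PROVED core
Theorem A at `2` on `Δ < 0`, p669276). RANK-FREE. CONDITIONAL; nothing closed. [cite: Kato2004Asterisque, Thm. 12.6 (p. 222), Thm. 16.6 (2) (p. 271), §17.13 (pp. 279–280)]
[cite: GreenbergLNM1716, Conj. 1.11 (p. 64)] -/
theorem greenbergMuZeroTwoOrdNegDisc_of_muFreeValue_negDisc (hpair : exists_lambdaAdicLocalTatePairing_selmer_orthogonal)
    (hOK : exists_ordinaryKernelFunctional) (hPub : OrdPublishedInputsAtTwo)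
    (hVflat : ∀ (W : WeierstrassCurve ℚ) [W.IsElliptic] [W.IsGloballyMinimal]
      [ContinuousSMul ℤ_[2] (W.tateModule 2)] [Module.Free ℤ_[2] (W.tateModule 2)] [Module.Finite ℤ_[2] (W.tateModule 2)]
      {N : ℕ} [NeZero N] (f : CuspForm (Gamma0 N) 2)
      (κ : ZpExtension ℚ 2) (γ : absoluteGaloisGroup ℚ) (hκ : κ.IsCyclotomic) (hγ : κ.IsTopGenerator γ),
      W.Δ < 0 → IsOrdinaryAt W 2 → W.HasSurjectiveModNGaloisRep 2 → IsCyclotomicVariable 2 γ → IsNewformOf W f →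
      ∀ (v₂ : HeightOneSpectrum (𝓞 ℚ)) (_ : ((2 : ℕ) : 𝓞 ℚ) ∈ v₂.asIdeal)
        (γᵥ : absoluteGaloisGroup (v₂.adicCompletion ℚ))
        (hsurj : Function.Surjective
          (κ.toContinuousMonoidHom.comp (resGalOfEmb (closureEmb (K := ℚ) (v₂.adicCompletion ℚ)))))
        (hγᵥ : κ.IsTopGenerator (resGalOfEmb (closureEmb (K := ℚ) (v₂.adicCompletion ℚ)) γᵥ))
        (I : IwasawaH1Data W 2 κ γ) (J : LocalIwasawaH1Data κ v₂ ((tateRep W 2).toLocal v₂) γᵥ)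
        (J' : LocalIwasawaH1Data κ v₂ (tateLocalOrdinaryRep W 2 v₂) γᵥ)
        (col : J.H →ₗ[IwasawaAlgebra 2] IwasawaAlgebra 2),
        (∀ x : J.H, col x = 0 ↔ x ∈ LinearMap.range (J'.ordinaryInclusion J)) →
        (∃ x : J.H, col x ∉ IwasawaAlgebra.augIdealP 2) →
        ∃ g : I.H, IsEulerSystemClassTwo W hκ I g ∧ col (I.loc J hsurj hγ hγᵥ g) ∉ IwasawaAlgebra.augIdealP 2) :
    GreenbergMuZeroTwoOrdNegDisc := by
  intro W _ _ hgo h2 hΔ κ γ hκ hγ hγ' D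
  obtain ⟨hmod, -, -, -⟩ := hPub
  haveI : NeZero (W.conductorNorm ℤ) := ⟨(W.conductorNorm_pos_holds).ne'⟩
  obtain ⟨Dm⟩ := hmod W
  exact mu_eq_zero_of_iotaNegDisc (zetaColemanMuIotaNegDiscAtTwo_of_tateDuality_of_ordKernel_of_muFreeValue hpair hOK hVflat)
    W hgo h2 hΔ Dm.f Dm.isNewformOf κ γ hκ hγ hγ' D

/-- **(⇒, second half) V♭⁻ ⟹ MU13⁻** over `Kato2004.thm12_4` (Thm. 12.4 (2): `rank_Λ 𝐇¹_Γ(T₂W) = 1`), p727215 (a normalised ordinary-kernel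
functional EXISTS) and PUB (modularity, for a newform of `W`): at the place of `ℚ` over `2` (`Rat.HeightOneSpectrum.primesEquiv`), a normalised
local generator (`exists_isTopGenerator_resGalOfEmb_adicCompletion`, `surjective_comp_resGalOfEmb_of_isCyclotomic`) and the pinned local carriers
(`nonempty_localIwasawaH1Data`) — all theorems —, V♭⁻ hands a GENUINE `z` with `col(loc₂ z) ∉ (2)`; then `col ∘ loc₂` is injective on the
torsion-free (`IwasawaH1Data.isTorsionFree`, theorem) rank-`1` `𝐇¹_Γ` and `𝐇¹_Γ ⧸ Λz ↪ Λ ⧸ (col(loc₂ z))`, finitely generated over `ℤ₂` by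
Weierstrass preparation (`Kato2004.moduleFinite_iwasawaH1_quotient_span_of_notMem_col_loc_of_thm12_4`). CONDITIONAL; nothing closed.
[cite: Kato2004Asterisque, Thm. 12.4 (2) (p. 221), Prop. 17.11 (p. 277), §17.13 (p. 280)] [cite: Washington1997, §7.1 Thm. 7.3] -/
theorem zetaQuotientMuZeroTwoOrdNegDisc_of_muFreeValue_negDisc (h12 : thm12_4) (hOK : exists_ordinaryKernelFunctional)
    (hPub : OrdPublishedInputsAtTwo)
    (hVflat : ∀ (W : WeierstrassCurve ℚ) [W.IsElliptic] [W.IsGloballyMinimal]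
      [ContinuousSMul ℤ_[2] (W.tateModule 2)] [Module.Free ℤ_[2] (W.tateModule 2)] [Module.Finite ℤ_[2] (W.tateModule 2)]
      {N : ℕ} [NeZero N] (f : CuspForm (Gamma0 N) 2)
      (κ : ZpExtension ℚ 2) (γ : absoluteGaloisGroup ℚ) (hκ : κ.IsCyclotomic) (hγ : κ.IsTopGenerator γ),
      W.Δ < 0 → IsOrdinaryAt W 2 → W.HasSurjectiveModNGaloisRep 2 → IsCyclotomicVariable 2 γ → IsNewformOf W f →
      ∀ (v₂ : HeightOneSpectrum (𝓞 ℚ)) (_ : ((2 : ℕ) : 𝓞 ℚ) ∈ v₂.asIdeal)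
        (γᵥ : absoluteGaloisGroup (v₂.adicCompletion ℚ))
        (hsurj : Function.Surjective
          (κ.toContinuousMonoidHom.comp (resGalOfEmb (closureEmb (K := ℚ) (v₂.adicCompletion ℚ)))))
        (hγᵥ : κ.IsTopGenerator (resGalOfEmb (closureEmb (K := ℚ) (v₂.adicCompletion ℚ)) γᵥ))
        (I : IwasawaH1Data W 2 κ γ) (J : LocalIwasawaH1Data κ v₂ ((tateRep W 2).toLocal v₂) γᵥ)
        (J' : LocalIwasawaH1Data κ v₂ (tateLocalOrdinaryRep W 2 v₂) γᵥ)
        (col : J.H →ₗ[IwasawaAlgebra 2] IwasawaAlgebra 2),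
        (∀ x : J.H, col x = 0 ↔ x ∈ LinearMap.range (J'.ordinaryInclusion J)) →
        (∃ x : J.H, col x ∉ IwasawaAlgebra.augIdealP 2) →
        ∃ g : I.H, IsEulerSystemClassTwo W hκ I g ∧ col (I.loc J hsurj hγ hγᵥ g) ∉ IwasawaAlgebra.augIdealP 2) :
    ZetaQuotientMuZeroTwoOrdNegDisc := by
  intro W _ _ _ _ _ κ γ hκ hγ hΔ hord h2 hγ' I
  -- a newform of `W` (modularity, PUB)
  obtain ⟨hmod, -, -, -⟩ := hPub
  haveI : NeZero (W.conductorNorm ℤ) := ⟨(W.conductorNorm_pos_holds).ne'⟩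
  obtain ⟨Dm⟩ := hmod W
  -- the carriers at the place over `2`
  obtain ⟨v₂, hv₂⟩ : ∃ v : HeightOneSpectrum (𝓞 ℚ), ((2 : ℕ) : 𝓞 ℚ) ∈ v.asIdeal :=
    ⟨(Rat.HeightOneSpectrum.primesEquiv (R := 𝓞 ℚ)).symm ⟨2, Nat.prime_two⟩,
      (natCast_mem_asIdeal_iff_eq_primesEquiv_symm _ Nat.prime_two).mpr rfl⟩
  obtain ⟨γᵥ, hγᵥ⟩ := hκ.exists_isTopGenerator_resGalOfEmb_adicCompletion v₂ hv₂
  have hsurj := surjective_comp_resGalOfEmb_of_isCyclotomic (κ := κ) (v := v₂) hκ hv₂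
  obtain ⟨J⟩ := nonempty_localIwasawaH1Data κ v₂ ((tateRep W 2).toLocal v₂) γᵥ
  obtain ⟨J'⟩ := nonempty_localIwasawaH1Data κ v₂ (tateLocalOrdinaryRep W 2 v₂) γᵥ
  -- the normalised ordinary-kernel functional (p727215 at `2`) and the genuine class of V♭⁻
  obtain ⟨col, hker, hnorm⟩ := hOK 2 W κ v₂ γᵥ hκ hv₂ hord hγᵥ J J'
  obtain ⟨z, hz, hval⟩ := hVflat W Dm.f κ γ hκ hγ hΔ hord h2 hγ' Dm.isNewformOf v₂ hv₂ γᵥ hsurj hγᵥ I J J' col hker hnorm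
  exact ⟨z, hz, moduleFinite_iwasawaH1_quotient_span_of_notMem_col_loc_of_thm12_4 h12 W κ γ hκ hγ v₂ γᵥ hsurj hγᵥ I J col z hval⟩

/-! ## §3 The split BY NAME, and F1μι⁻ from {G11⁻, MU13⁻} -/

/-- **LOSSLESS SPLIT of the registered `Δ < 0` memo stub: V♭⁻ ⟺ G11⁻ ∧ MU13⁻**, modulo the print inputs BY NAME — the Poitou–Tate exactness
fact p729889 (whose projection is p723619, `exists_lambdaAdicLocalTatePairing_selmer_orthogonal_of_poitouTate_exact`), p727215, `thm12_4` and PUB.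
Neither side is proved; nothing asserted. [cite: Kato2004Asterisque, Thm. 12.4 (2) (p. 221), §17.13 (pp. 279–280)] [cite: GreenbergLNM1716, Conj. 1.11 (p. 64)] -/
theorem muFreeValue_negDisc_iff_greenbergMuNeg_and_zetaQuotientMu (hPT : exists_lambdaAdicLocalTatePairing_poitouTate_exact)
    (hOK : exists_ordinaryKernelFunctional) (h12 : thm12_4) (hPub : OrdPublishedInputsAtTwo) :
    (∀ (W : WeierstrassCurve ℚ) [W.IsElliptic] [W.IsGloballyMinimal]
      [ContinuousSMul ℤ_[2] (W.tateModule 2)] [Module.Free ℤ_[2] (W.tateModule 2)] [Module.Finite ℤ_[2] (W.tateModule 2)]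
      {N : ℕ} [NeZero N] (f : CuspForm (Gamma0 N) 2)
      (κ : ZpExtension ℚ 2) (γ : absoluteGaloisGroup ℚ) (hκ : κ.IsCyclotomic) (hγ : κ.IsTopGenerator γ),
      W.Δ < 0 → IsOrdinaryAt W 2 → W.HasSurjectiveModNGaloisRep 2 → IsCyclotomicVariable 2 γ → IsNewformOf W f →
      ∀ (v₂ : HeightOneSpectrum (𝓞 ℚ)) (_ : ((2 : ℕ) : 𝓞 ℚ) ∈ v₂.asIdeal)
        (γᵥ : absoluteGaloisGroup (v₂.adicCompletion ℚ))
        (hsurj : Function.Surjective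
          (κ.toContinuousMonoidHom.comp (resGalOfEmb (closureEmb (K := ℚ) (v₂.adicCompletion ℚ)))))
        (hγᵥ : κ.IsTopGenerator (resGalOfEmb (closureEmb (K := ℚ) (v₂.adicCompletion ℚ)) γᵥ))
        (I : IwasawaH1Data W 2 κ γ) (J : LocalIwasawaH1Data κ v₂ ((tateRep W 2).toLocal v₂) γᵥ)
        (J' : LocalIwasawaH1Data κ v₂ (tateLocalOrdinaryRep W 2 v₂) γᵥ)
        (col : J.H →ₗ[IwasawaAlgebra 2] IwasawaAlgebra 2),
        (∀ x : J.H, col x = 0 ↔ x ∈ LinearMap.range (J'.ordinaryInclusion J)) →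
        (∃ x : J.H, col x ∉ IwasawaAlgebra.augIdealP 2) →
        ∃ g : I.H, IsEulerSystemClassTwo W hκ I g ∧ col (I.loc J hsurj hγ hγᵥ g) ∉ IwasawaAlgebra.augIdealP 2) ↔
    (GreenbergMuZeroTwoOrdNegDisc ∧ ZetaQuotientMuZeroTwoOrdNegDisc) :=
  ⟨fun hV => ⟨greenbergMuZeroTwoOrdNegDisc_of_muFreeValue_negDisc
      (exists_lambdaAdicLocalTatePairing_selmer_orthogonal_of_poitouTate_exact hPT) hOK hPub hV,
    zetaQuotientMuZeroTwoOrdNegDisc_of_muFreeValue_negDisc h12 hOK hPub hV⟩,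
   fun h => muFreeValue_negDisc_of_greenbergMuNeg_of_zetaQuotientMu hPT hPub h.1 h.2⟩

/-- **F1μι⁻ = `ZetaColemanMuIotaNegDiscAtTwo` (conjunct 1 of child 24097) BY NAME from {G11⁻, MU13⁻}** over p729889, p727215 and PUB: (⇐) of
§1 followed by w3 g5's p727801. CONDITIONAL on the displayed OPEN statements; nothing closed.
[cite: Kato2004Asterisque, Thm. 12.6 (p. 222), Thm. 16.6 (2) (p. 271), Prop. 17.11 (p. 277), §17.13 (pp. 279–280)] [cite: GreenbergLNM1716, Conj. 1.11 (p. 64)] -/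
theorem zetaColemanMuIotaNegDiscAtTwo_of_greenbergMuNeg_of_zetaQuotientMu (hPT : exists_lambdaAdicLocalTatePairing_poitouTate_exact)
    (hOK : exists_ordinaryKernelFunctional) (hPub : OrdPublishedInputsAtTwo) (hG : GreenbergMuZeroTwoOrdNegDisc)
    (hZ : ZetaQuotientMuZeroTwoOrdNegDisc) : ZetaColemanMuIotaNegDiscAtTwo :=
  zetaColemanMuIotaNegDiscAtTwo_of_tateDuality_of_ordKernel_of_muFreeValue
    (exists_lambdaAdicLocalTatePairing_selmer_orthogonal_of_poitouTate_exact hPT) hOK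
    (muFreeValue_negDisc_of_greenbergMuNeg_of_zetaQuotientMu hPT hPub hG hZ)

/-- **The PAIR child `OrdKatoFineZetaAtTwoResidue` (stmt-BirchSwinnertonDyer-24097) BY NAME from {G11⁻, MU13⁻} and its `0 < Δ` conjunct**
(the latter is G11⁺ + Abbes–Ullmo + Kato 17.4 (1)(2) at `2` by w3 g6's `ordKatoHalfAtTwoIsoPosDisc_of_greenbergMuZero`, p734050 — kept as the
hypothesis `hPos` here), over p729889, p727215 and PUB: F1μι⁻ from §3, then the lead g6's `ordKatoFineZetaAtTwoResidue_of_halves` (p700774).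
So child 24097 ⟸ Greenberg's Conjecture 1.11 at `2` on BOTH onto cells + MU13⁻ + print. CONDITIONAL on the displayed OPEN statements; nothing closed.
[cite: Kato2004Asterisque, Thm. 17.4 (1)(2) (p. 273), §17.13 (pp. 279–280)] [cite: GreenbergLNM1716, Conj. 1.11 (p. 64)] -/
theorem ordKatoFineZetaAtTwoResidue_of_greenbergMuNeg_of_zetaQuotientMu_of_posDisc
    (hPT : exists_lambdaAdicLocalTatePairing_poitouTate_exact) (hOK : exists_ordinaryKernelFunctional) (hPub : OrdPublishedInputsAtTwo)
    (hG : GreenbergMuZeroTwoOrdNegDisc) (hZ : ZetaQuotientMuZeroTwoOrdNegDisc) (hPos : OrdKatoHalfAtTwoIsoPosDisc) :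
    OrdKatoFineZetaAtTwoResidue :=
  ordKatoFineZetaAtTwoResidue_of_halves (zetaColemanMuIotaNegDiscAtTwo_of_greenbergMuNeg_of_zetaQuotientMu hPT hOK hPub hG hZ) hPos

/-! ## §4 G11⁻ and the crux on the `Δ < 0` cell: the DIRECT road and NECESSITY (so G11⁻|habitat ⟺ the crux there, modulo print) -/

/-- **G11⁻ + Abbes–Ullmo + Kato 17.4 (1)(2) at `2` ⟹ Kato's integral lower divisibility `X5.O1.MainConjectureLowerDivisibilityAtTwoOrd W` AT
EVERY curve of the `Δ < 0` cell** (any rank, CM or not; `W′ := W`): the DIRECT road, sign-free twin of w3 g6's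
`ordKatoHalfAtTwoIsoPosDisc_of_greenbergMuZero` — `μ(X) = 0` for every datum is Kato's `μ`-part `O1.KatoMuPartAtTwo W`
(`O1.katoMuPartAtTwo_of_mu_eq_zero`), and Abbes–Ullmo makes the Néron ratio integral (`hint_two_of_abbesUllmo_of_irr`). No Euler system, no
Coleman map. CONDITIONAL; nothing closed. [cite: GreenbergLNM1716, Conj. 1.11 (p. 64)] [cite: Kato2004Asterisque, Thm. 17.4 (1)(2) (p. 273)]
[cite: AbbesUllmo1996, Thm. A] -/
theorem mainConjectureLowerDivisibilityAtTwoOrd_negDisc_of_greenbergMuNeg (hG : GreenbergMuZeroTwoOrdNegDisc)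
    (hAU : abbesUllmo_not_dvd_maninConstant_of_not_dvd_level)
    (h17 : ∀ (V : WeierstrassCurve ℚ) [V.IsElliptic] [V.IsGloballyMinimal] [NeZero (V.conductorNorm ℤ)]
      (f : CuspForm (Gamma0 (V.conductorNorm ℤ)) 2), kato_divisibility_allPrimes V 2 (f := f))
    (W : WeierstrassCurve ℚ) [W.IsElliptic] [W.IsGloballyMinimal]
    (hgo : GoodOrd W 2) (h2 : W.HasSurjectiveModNGaloisRep 2) (hΔ : W.Δ < 0) :
    O1.MainConjectureLowerDivisibilityAtTwoOrd W := by
  haveI : NeZero ((2 : ℕ) : ℚ) := ⟨by norm_num⟩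
  exact O1.mainConjectureLowerDivisibilityAtTwoOrd_of_katoMuPartAtTwo W (h17 W)
    (fun f hf ϖ hϖ => hint_two_of_abbesUllmo_of_irr hAU W hgo
      (hasIrreducibleModPGaloisRep_of_hasSurjectiveModNGaloisRep W 2 h2) f hf ϖ hϖ)
    (O1.katoMuPartAtTwo_of_mu_eq_zero W (fun κ γ hκ hγ hγ' D => hG W hgo h2 hΔ κ γ hκ hγ hγ' D))

/-- **G11⁻ + Abbes–Ullmo + Kato 17.4 (1)(2) at `2` ⟹ the crux `OrdKatoHalfAtTwoIso` ON THE `Δ < 0` ONTO CELL of its habitat** (the crux's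
conclusion «∃ an isogenous globally minimal `W′` with `MainConjectureLowerDivisibilityAtTwoOrd W′`» at every non-CM, analytic-rank-`0`,
good-ordinary-at-`2` `W` with `ρ̄_{W,2}` onto and `Δ_W < 0`, with `W′ := W`). With §2's `greenbergMuZeroTwoOrdNegDisc_of_muFreeValue_negDisc`
this re-derives the line's `Δ < 0` conclusion from V♭⁻ WITHOUT F1μι⁻'s structural `∃ (I Z P ℓ τ π)` packaging; with
`greenbergMuZeroTwoOrdNegDisc_habitat_of_ordKatoHalfAtTwoIso` below, G11⁻|habitat ⟺ the crux on this cell modulo print.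
CONDITIONAL; nothing closed. [cite: GreenbergLNM1716, Conj. 1.11 (p. 64)] [cite: Kato2004Asterisque, Thm. 17.4 (1)(2) (p. 273)] [cite: AbbesUllmo1996, Thm. A] -/
theorem ordKatoHalfAtTwoIso_negDisc_of_greenbergMuNeg (hG : GreenbergMuZeroTwoOrdNegDisc)
    (hAU : abbesUllmo_not_dvd_maninConstant_of_not_dvd_level)
    (h17 : ∀ (V : WeierstrassCurve ℚ) [V.IsElliptic] [V.IsGloballyMinimal] [NeZero (V.conductorNorm ℤ)]
      (f : CuspForm (Gamma0 (V.conductorNorm ℤ)) 2), kato_divisibility_allPrimes V 2 (f := f)) :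
    ∀ (W : WeierstrassCurve ℚ) [W.IsElliptic] [W.IsGloballyMinimal], ¬ W.HasCM → W.analyticRank = 0 → GoodOrd W 2 →
      W.HasSurjectiveModNGaloisRep 2 → W.Δ < 0 →
      ∃ (W' : WeierstrassCurve ℚ) (_ : W'.IsElliptic) (_ : W'.IsGloballyMinimal),
        IsIsogenous W W' ∧ O1.MainConjectureLowerDivisibilityAtTwoOrd W' := by
  intro W _ _ _ _ hgo h2 hΔ
  exact ⟨W, ‹_›, ‹_›, isIsogenous_self W,
    mainConjectureLowerDivisibilityAtTwoOrd_negDisc_of_greenbergMuNeg hG hAU h17 W hgo h2 hΔ⟩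

/-- **NECESSITY on the `Δ < 0` cell: the crux ⟹ G11⁻ RESTRICTED TO THE HABITAT** (non-CM, analytic rank `0`), granted PUB, Cassels and
Abbes–Ullmo BY NAME — the `Δ < 0` restriction of the lead g10's sign-free display `greenbergMu_two_onto_necessary` (skeleton v24 §4), ported to
the Theorems tree: the crux gives the Kato–Néron half at an isogenous `W′`, an ISOGENY-CLASS statement on K4's rank-`0` good-ordinary domain
(`IsogenyMuShift.katoHalf_isogenyInvariant`), hence Kato's `μ`-part at `W` (`O1.katoMuPartAtTwo_of_mainConjectureLowerDivisibilityAtTwoOrd`,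
Kato 17.4 (1) at `2`) and `μ(X) = 0` (`mu_eq_zero_of_katoMuPartAtTwo_of_irr`: `2^{μ(X)} ∣ ϖ·G`, `ϖ ∈ ℤ₂ˣ` by Abbes–Ullmo, `G ∉ (2)` by the
PROVED analytic `μ₂ = 0`). Off the habitat (positive analytic rank / CM) G11⁻ is Greenberg's conjecture proper and is NOT claimed necessary.
[cite: GreenbergLNM1716, §1 Conj. 1.11 (p. 64)] [cite: Kato2004Asterisque, Thm. 17.4 (1)(2) (p. 273)] [cite: MilneADT2006, Thm. I.7.3 (Cassels)]
[cite: AbbesUllmo1996, Thm. A] -/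
theorem greenbergMuZeroTwoOrdNegDisc_habitat_of_ordKatoHalfAtTwoIso (hcrux : OrdKatoHalfAtTwoIso) (hPub : OrdPublishedInputsAtTwo)
    (hCassels : bsdRHS_eq_of_isIsogenous) (hAU : abbesUllmo_not_dvd_maninConstant_of_not_dvd_level) :
    ∀ (W : WeierstrassCurve ℚ) [W.IsElliptic] [W.IsGloballyMinimal],
      ¬ W.HasCM → W.analyticRank = 0 → GoodOrd W 2 → W.HasSurjectiveModNGaloisRep 2 → W.Δ < 0 →
      ∀ (κ : ZpExtension ℚ 2) (γ : absoluteGaloisGroup ℚ), κ.IsCyclotomic → κ.IsTopGenerator γ →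
        IsCyclotomicVariable 2 γ → ∀ D : W.SelmerDualData κ γ, D.mu = 0 := by
  intro W _ _ hcm hr hgo h2 _ κ γ hκ hγ hγ' D
  obtain ⟨W', _, _, hiso, hK'⟩ := hcrux W hcm hr hgo
  have hP := hPub
  obtain ⟨hmod, -, h17, -⟩ := hP
  exact mu_eq_zero_of_katoMuPartAtTwo_of_irr W hAU hmod hgo (hasIrreducibleModPGaloisRep_of_hasSurjectiveModNGaloisRep W 2 h2)
    (O1.katoMuPartAtTwo_of_mainConjectureLowerDivisibilityAtTwoOrd W (fun f ↦ h17 W f)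
      (Summit.BirchSwinnertonDyer.BirchSwinnertonDyer.Theorems.IsogenyMuShift.katoHalf_isogenyInvariant hPub hCassels hiso
        hgo hr hK'))
    hκ hγ hγ' D

/-! ## §5 (appended) MU13⁻ forbids `2`-divisible Euler systems on the `Δ < 0` cell — its first visible test, in the Negative lemma's currency -/

/-- **MU13⁻ ⟹ N2D⁻: at every curve of the `Δ < 0` cell and every pinned `𝐇¹_Γ(T₂W)` some GENUINE `2`-adic Euler-system class is NOT divisible by
`2` in `𝐇¹_Γ`** (`z ∉ (2)·𝐇¹_Γ`), granted Kato Thm. 12.4 (2) (`thm12_4`: `𝐇¹_Γ ≠ 0` — the junk exclusion of MU13⁻). Mechanism (w3 g7 Literature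
`IwasawaH1Data.not_mem_augIdealP_smul_top_of_moduleFinite_quotient_span_of_thm12_4`): `z = 2•w` would give an `X`-monic relation on `w̄` in
`𝐇¹_Γ ⧸ Λz`, i.e. an `X`-monic element of `(2)`. The currency `augIdealP 2 • ⊤` is that of the disprover's Negative lemma p691215
(`…OrdKatoHalfAtTwoIso/Negative/ZetaColemanMuTwoDivisible`: «all genuine classes `2`-divisible at one habitat curve ⟹ F1μ fails»); the lead's
F-27a locates why `Δ < 0` (rhombic period lattice, `c_∞ = 1`) is where non-divisibility is expected. CONDITIONAL on MU13⁻; nothing closed.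
[cite: Kato2004Asterisque, Thm. 12.4 (2) (p. 221), Thm. 12.6 (p. 222), §17.13 (p. 280)] -/
theorem exists_isEulerSystemClassTwo_not_mem_two_smul_top_of_zetaQuotientMu (h12 : thm12_4) (hZ : ZetaQuotientMuZeroTwoOrdNegDisc) :
    ∀ (W : WeierstrassCurve ℚ) [W.IsElliptic] [W.IsGloballyMinimal]
      [ContinuousSMul ℤ_[2] (W.tateModule 2)] [Module.Free ℤ_[2] (W.tateModule 2)] [Module.Finite ℤ_[2] (W.tateModule 2)]
      (κ : ZpExtension ℚ 2) (γ : absoluteGaloisGroup ℚ) (hκ : κ.IsCyclotomic),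
      κ.IsTopGenerator γ → W.Δ < 0 → IsOrdinaryAt W 2 → W.HasSurjectiveModNGaloisRep 2 → IsCyclotomicVariable 2 γ →
      ∀ I : IwasawaH1Data W 2 κ γ,
        ∃ z : I.H, IsEulerSystemClassTwo W hκ I z ∧ z ∉ IwasawaAlgebra.augIdealP 2 • (⊤ : Submodule (IwasawaAlgebra 2) I.H) := by
  intro W _ _ _ _ _ κ γ hκ hγ hΔ hord h2 hγ' I
  obtain ⟨z, hz, hfin⟩ := hZ W κ γ hκ hγ hΔ hord h2 hγ' I
  exact ⟨z, hz, I.not_mem_augIdealP_smul_top_of_moduleFinite_quotient_span_of_thm12_4 h12 hκ hγ hfin⟩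

/-- **MU13⁻ REFUTES the `2`-divisibility hypothesis of the Negative lemma p691215 at EVERY curve of the `Δ < 0` cell** (granted `thm12_4`): it is
false that all genuine `2`-adic Euler-system classes of all pinned `𝐇¹_Γ(T₂W)` lie in `(2)·𝐇¹_Γ` (a pinned `𝐇¹_Γ` exists: `nonempty_iwasawaH1Data_holds`).
So `zetaColemanMuInputsAtTwo_false_of_twoDivisible` cannot fire on `Δ < 0` under MU13⁻ — consistent with the sign split of child 24097.
CONDITIONAL; nothing closed. [cite: Kato2004Asterisque, Thm. 12.4 (2) (p. 221), §17.13 (p. 280)] -/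
theorem not_forall_isEulerSystemClassTwo_mem_two_smul_top_of_zetaQuotientMu (h12 : thm12_4) (hZ : ZetaQuotientMuZeroTwoOrdNegDisc)
    (W : WeierstrassCurve ℚ) [W.IsElliptic] [W.IsGloballyMinimal]
    [ContinuousSMul ℤ_[2] (W.tateModule 2)] [Module.Free ℤ_[2] (W.tateModule 2)] [Module.Finite ℤ_[2] (W.tateModule 2)]
    (κ : ZpExtension ℚ 2) (γ : absoluteGaloisGroup ℚ) (hκ : κ.IsCyclotomic) (hγ : κ.IsTopGenerator γ)
    (hΔ : W.Δ < 0) (hord : IsOrdinaryAt W 2) (h2 : W.HasSurjectiveModNGaloisRep 2) (hγ' : IsCyclotomicVariable 2 γ) :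
    ¬ ∀ (I : IwasawaH1Data W 2 κ γ) (s : I.H), IsEulerSystemClassTwo W hκ I s →
        s ∈ IwasawaAlgebra.augIdealP 2 • (⊤ : Submodule (IwasawaAlgebra 2) I.H) := by
  intro hdiv
  obtain ⟨I⟩ := nonempty_iwasawaH1Data_holds W 2 κ γ hκ hγ
  obtain ⟨z, hz, hnot⟩ :=
    exists_isEulerSystemClassTwo_not_mem_two_smul_top_of_zetaQuotientMu h12 hZ W κ γ hκ hγ hΔ hord h2 hγ' I
  exact hnot (hdiv I z hz)

end Summit.BirchSwinnertonDyer.BirchSwinnertonDyer.Theorems.SteinbergFibreAtTwo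

end
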